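import Summits.ResolutionOfSingularities.ResolutionOfSingularities.Theorems.PurelyInseparableDim4ChartChainHistory
import Summits.ResolutionOfSingularities.ResolutionOfSingularities.Theorems.PurelyInseparableDim4ChartChainMonotoneT
import HarnessLib

/-!
# Purely inseparable four-folds `z^p + F(x₁, …, x₄)`: DEPTH-THREE CHAINS COMPLETE — under the history
# condition the walk's third coordinate centre is not only closed but BGMW-admissible
# (brick TY-2 g3 (a3) of cell `res-dim4-pi`)

[OURS · counted 0] (D-0157 DOOR 2; director-resolution DR-157-C; desk WORD #66 (4); frame
`PIDim4.TerminationImpliesOrderReduction`, S3 (c) coordinate regime). Sequel of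
`PurelyInseparableDim4ChartChainHistory.lean` (depth-3 closedness criterion) and typ-2 g2's
`PurelyInseparableDim4ChartChainMonotoneT.lean` (INVARIANT-T and the unconditional step along `S' ⊆ S''`).
g2's `chainT_step` re-establishes INVARIANT-T (closedness of the next centre + TRANSLATED SHAPE of the
boundary) only for next centres `S'' ⊇ S'`, i.e. inside the newest exceptional divisor. At depth three the
missing steps are `S'.erase j' ⊆ S'' ∌ j'` (drop the chart variable: e.g. point → point → curve). PROVED here
(no `sorry`, no new axiom):

* §1 **`shapeT_transform_singleton`** (any ambient `Z`, any open-immersion chart `φ`): if the boundary is ONE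
  member `E₁` reading `V(x_j)` on `φ`, then after any blowing up `π₂` of the global centre of `φ(V(z, x_{S'}))`
  and on any re-centred chart of the chart (`j' ∈ S'`, `b'`), the new boundary `[σˢ E₁, E₂]` has the translated
  shape relative to EVERY `S''` — it reads `[V(x_j + b'_j) or ∅ (j = j'), V(x_{j'})]`, and a member with index in
  `S''` and nonzero constant misses the centre. No inclusion `S' ⊆ S''` is needed because the reading of the
  single old member is known whether or not it meets the old centre.
* §2 **`chainT_step_history`** — THE DEPTH-THREE STEP: at `Z = W` the first blow-up of `𝔸⁵` along `V(z, x_S)`,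
  with a chart `φ` of history `φ ≫ π = Spec (Θ ∘ ψ_j)` on which `M₁` (multiplicity `p`, boundary `[E₁]` reading
  `V(x_j)`) reads `(z^p + s₁.F)·𝒪`, `S.erase j ⊆ S'`, `φ(V(z, x_{S'}))` closed, `p ≤ ord_{(x_{S'})} s₁.F`: for ANY
  blowing up `π₂` of the global centre and every `j' ∈ S'`, `b'`: `IsMultipleBlowup M₀ (π₂ ≫ π) M₂`,
  `HasSNC M₂.boundary`, a chart of the chart reading `(z^p + (step p S' j' b' s₁).F)·𝒪`, AND INVARIANT-T
  (closedness + translated shape with injective index) relative to every `S''` with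
  `S'.erase j' ⊆ S'' ∌ j'` satisfying the HISTORY CONDITION
  `j' ∉ S.erase j ∨ (∃ k ∈ S' ∖ S, b'_k ≠ 0) ∨ (j ∈ S'' ∧ b'_j ≠ 0)` — exactly the input of g2's `chainT_step`
  at the next level. Hence every depth-3 branch `V(z,x_S) → V(z,x_{S'}) → V(z,x_{S''})` of the walk with
  `S.erase j ⊆ S'`, `S'.erase j' ⊆ S''` and the history condition (the case `S' ⊆ S''` being g2's) is, through
  ANY blowings up, a BGMW `IsMultipleBlowup` of `(𝔸⁵, (z^p + F)·𝒪, [], p)` whose last transform reads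
  `(z^p + s₃.F)·𝒪` on a chart (apply `chainT_step` once more); when the history condition fails the third centre
  has no verbatim global counterpart (`isClosed_image_CΛ_depth_three_iff`). Depth ≤ 3 is thereby classified.

FRONTIER (not typed): at depth ≥ 4 an old boundary member can read a CURVED hypersurface on the chart
(`V(x_{j''}(x_j + b''_j) + b'_j)` when `j ∈ S'' ∖ {j''}`, `b'_j ≠ 0`), outside the translated-hyperplane snc
lemma — the FC-1 input there needs an snc lemma for such members. Nothing here is a statement about resolution
of singularities in dimension ≥ 4 / characteristic `p` (NOT proved anywhere in this programme). bears_on: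
LADDER-RESOLUTION:D157-DOOR2 (res-dim4-pi). Supports stmt-ResolutionOfSingularities-16155 (helper, TY-2 g3 (a3)).
-/

-- every declaration of this summit lives under `Summit.ResolutionOfSingularities.ResolutionOfSingularities`
-- (summit = problem), which the duplicate-namespace linter flags; house convention (cf. the Target file).
set_option linter.dupNamespace false

noncomputable section

open MvPolynomial Finset CategoryTheory AlgebraicGeometry Opposite TopologicalSpace
open AlgebraicGeometry.Scheme.IdealSheafData (ofIdealTop vanishingIdeal)

namespace Summit.ResolutionOfSingularities.ResolutionOfSingularities.Theorems.PIDim4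

open Literature.AlgebraicGeometry.Resolution
open Literature.AlgebraicGeometry.Resolution.AffinePointBlowup (P A γ coord Wtop)

namespace ChartDictionary

/-! ## §1 The translated shape after a step from a ONE-member boundary, for every next centre -/

section Singleton

variable {K : Type} [Field K] {Z W₂ : Scheme.{0}} (φ : P 4 K ⟶ Z) [IsOpenImmersion φ] {π₂ : W₂ ⟶ Z}
  {S' : Finset (Fin 4)} {j j' : Fin 4}

/-- **TRANSLATED SHAPE from a one-member boundary, for EVERY next centre.** Let the boundary consist of ONE
member `E₁` reading `V(x_j)` on the chart `φ`. After any blowing up `π₂` of the global centre of `φ(V(z, x_{S'}))`,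
on the re-centred chart of the chart `φ''` (`j' ∈ S'`, `Θ' xᵢ = xᵢ + b'ᵢ`, `b'_{j'} = 0`) the new boundary
`[σˢ E₁, E₂]` has the translated shape relative to every `S''`: each member meeting `φ''(V(z, x_{S''}))` reads
`V(x_{idx} + cst)` with `cst = 0` if `idx ∈ S''` (`σˢ E₁ ↦ (j, b'_j)`, `E₂ ↦ (j', 0)`), and `idx` is injective on
the meeting members. -/
theorem shapeT_transform_singleton [IsLocallyNoetherian Z]
    (hπ₂ : IsBlowup π₂ (vanishingIdeal (closureImage φ
      ((AffineCoordBlowup.𝓘Λ 4 K (insert 0 (Fin.succ '' (S' : Set (Fin 4))))).support : Set (P 4 K)))))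
    (hj' : j' ∈ S') {b' : Fin 4 → K} (hbj' : b' j' = 0) {Θ' : A 4 K ≃ₐ[K] A 4 K}
    (hs' : ∀ i : Fin 4, Θ' (X i.succ) = X i.succ + C (b' i)) {E₁ : Z.IdealSheafData}
    (hE₁ : E₁.comap φ = ofIdealTop (Ideal.span {coord 4 K j.succ})) (S'' : Finset (Fin 4)) :
    ∃ (idx₂ : W₂.IdealSheafData → Fin 4) (cst₂ : W₂.IdealSheafData → K),
      (∀ D₂ ∈ [E₁].map (strictTransformIdeal π₂ (vanishingIdeal (closureImage φ
          ((AffineCoordBlowup.𝓘Λ 4 K (insert 0 (Fin.succ '' (S' : Set (Fin 4))))).support : Set (P 4 K))))) ++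
        [(vanishingIdeal (closureImage φ
          ((AffineCoordBlowup.𝓘Λ 4 K (insert 0 (Fin.succ '' (S' : Set (Fin 4))))).support : Set (P 4 K)))).comap π₂],
        ((D₂.support : Set W₂) ∩ (Spec.map (CommRingCat.ofHom (Θ' : A 4 K →+* A 4 K)) ≫
            AffineCoordBlowup.chartImm (isBlowup_restrict_globalCentre φ _ hπ₂) (succ_mem_centreVars hj') ≫
              (π₂ ⁻¹ᵁ φ.opensRange).ι) ''
          (AffineCoordBlowup.CΛ 4 K (insert 0 (Fin.succ '' (S'' : Set (Fin 4)))) : Set (P 4 K))).Nonempty →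
        D₂.comap (Spec.map (CommRingCat.ofHom (Θ' : A 4 K →+* A 4 K)) ≫
            AffineCoordBlowup.chartImm (isBlowup_restrict_globalCentre φ _ hπ₂) (succ_mem_centreVars hj') ≫
              (π₂ ⁻¹ᵁ φ.opensRange).ι) =
          ofIdealTop (Ideal.span {(γ 4 K).symm (X (idx₂ D₂).succ + C (cst₂ D₂))}) ∧ (idx₂ D₂ ∈ S'' → cst₂ D₂ = 0)) ∧
      (∀ D₁ ∈ [E₁].map (strictTransformIdeal π₂ (vanishingIdeal (closureImage φ
          ((AffineCoordBlowup.𝓘Λ 4 K (insert 0 (Fin.succ '' (S' : Set (Fin 4))))).support : Set (P 4 K))))) ++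
        [(vanishingIdeal (closureImage φ
          ((AffineCoordBlowup.𝓘Λ 4 K (insert 0 (Fin.succ '' (S' : Set (Fin 4))))).support : Set (P 4 K)))).comap π₂],
        ∀ D₂ ∈ [E₁].map (strictTransformIdeal π₂ (vanishingIdeal (closureImage φ
          ((AffineCoordBlowup.𝓘Λ 4 K (insert 0 (Fin.succ '' (S' : Set (Fin 4))))).support : Set (P 4 K))))) ++
        [(vanishingIdeal (closureImage φ
          ((AffineCoordBlowup.𝓘Λ 4 K (insert 0 (Fin.succ '' (S' : Set (Fin 4))))).support : Set (P 4 K)))).comap π₂],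
        ((D₁.support : Set W₂) ∩ (Spec.map (CommRingCat.ofHom (Θ' : A 4 K →+* A 4 K)) ≫
            AffineCoordBlowup.chartImm (isBlowup_restrict_globalCentre φ _ hπ₂) (succ_mem_centreVars hj') ≫
              (π₂ ⁻¹ᵁ φ.opensRange).ι) ''
          (AffineCoordBlowup.CΛ 4 K (insert 0 (Fin.succ '' (S'' : Set (Fin 4)))) : Set (P 4 K))).Nonempty →
        ((D₂.support : Set W₂) ∩ (Spec.map (CommRingCat.ofHom (Θ' : A 4 K →+* A 4 K)) ≫
            AffineCoordBlowup.chartImm (isBlowup_restrict_globalCentre φ _ hπ₂) (succ_mem_centreVars hj') ≫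
              (π₂ ⁻¹ᵁ φ.opensRange).ι) ''
          (AffineCoordBlowup.CΛ 4 K (insert 0 (Fin.succ '' (S'' : Set (Fin 4)))) : Set (P 4 K))).Nonempty →
        idx₂ D₁ = idx₂ D₂ → D₁ = D₂) := by
  classical
  haveI : IsIso (CommRingCat.ofHom (Θ' : A 4 K →+* A 4 K)) :=
    (inferInstance : IsIso Θ'.toRingEquiv.toCommRingCatIso.hom)
  haveI : IsProper π₂ := hπ₂.isProper
  haveI : IsLocallyNoetherian W₂ := LocallyOfFiniteType.isLocallyNoetherian π₂
  have hs'' : ∀ i : Fin 4, (Θ' : A 4 K →+* A 4 K) (X i.succ) = X i.succ + C (b' i) := fun i => hs' i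
  have hΘ'j : (Θ' : A 4 K →+* A 4 K) (X j'.succ) = X j'.succ := by rw [hs'' j', hbj', C_0, add_zero]
  -- notation
  set Zc := vanishingIdeal (closureImage φ
    ((AffineCoordBlowup.𝓘Λ 4 K (insert 0 (Fin.succ '' (S' : Set (Fin 4))))).support : Set (P 4 K))) with hZc
  set φ'' := Spec.map (CommRingCat.ofHom (Θ' : A 4 K →+* A 4 K)) ≫
    AffineCoordBlowup.chartImm (isBlowup_restrict_globalCentre φ _ hπ₂) (succ_mem_centreVars hj') ≫
      (π₂ ⁻¹ᵁ φ.opensRange).ι with hφ''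
  set T'' := φ'' '' (AffineCoordBlowup.CΛ 4 K (insert 0 (Fin.succ '' (S'' : Set (Fin 4)))) : Set (P 4 K)) with hT''
  -- membership in the two-member boundary
  have hmem : ∀ D₂ ∈ [E₁].map (strictTransformIdeal π₂ Zc) ++ [Zc.comap π₂],
      D₂ = strictTransformIdeal π₂ Zc E₁ ∨ D₂ = Zc.comap π₂ := by
    intro D₂ hD₂
    simpa only [List.map_cons, List.map_nil, List.singleton_append, List.mem_cons, List.mem_singleton,
      List.not_mem_nil, or_false] using hD₂
  -- the old member with index `j'` misses the chart of the chart
  have hself : j = j' → ¬ (((strictTransformIdeal π₂ Zc E₁).support : Set W₂) ∩ T'').Nonempty := by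
    rintro hjj ⟨w, hw1, y, hy, rfl⟩
    subst hjj
    have htop := comap_strictTransformIdeal_hyperplane_self_chart_of_chart φ hj' hπ₂ (Θ' : A 4 K →+* A 4 K) hE₁
    have h1 : y ∈ ((strictTransformIdeal π₂ Zc E₁).comap φ'').support := by
      rw [Scheme.IdealSheafData.support_comap]; exact hw1
    rw [hφ'', hZc, htop, Scheme.IdealSheafData.support_top] at h1
    exact h1
  -- the old member with index `j ≠ j'` reads `V(x_j + b'_j)`
  have hread : j ≠ j' → (strictTransformIdeal π₂ Zc E₁).comap φ'' =
      ofIdealTop (Ideal.span {(γ 4 K).symm (X j.succ + C (b' j))}) := by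
    intro hjj
    rw [hφ'', hZc]
    exact comap_strictTransformIdeal_hyperplane_chart_of_chart φ hj' hπ₂ hjj (hs'' j) hE₁
  refine ⟨fun D₂ => if D₂ = Zc.comap π₂ then j' else j, fun D₂ => if D₂ = Zc.comap π₂ then 0 else b' j, ?_, ?_⟩
  · -- the readings
    intro D₂ hD₂ hm₂
    by_cases hnew : D₂ = Zc.comap π₂
    · subst hnew
      beta_reduce
      rw [if_pos rfl, if_pos rfl]
      refine ⟨?_, fun _ => rfl⟩
      rw [C_0, add_zero, hφ'', hZc, comap_comap_globalCentre_chart_of_chart φ hj' hΘ'j hπ₂]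
      rfl
    · beta_reduce
      rw [if_neg hnew, if_neg hnew]
      have hD₂' : D₂ = strictTransformIdeal π₂ Zc E₁ := (hmem D₂ hD₂).resolve_right hnew
      subst hD₂'
      have hjj : j ≠ j' := fun h => hself h hm₂
      refine ⟨hread hjj, fun hjS'' => ?_⟩
      -- meeting `V(z, x_{S''})` with index in `S''` forces the constant to vanish
      by_contra hne
      obtain ⟨w, hw1, y, hy, rfl⟩ := hm₂
      have h1 : y ∈ ((strictTransformIdeal π₂ Zc E₁).comap φ'').support := by
        rw [Scheme.IdealSheafData.support_comap]; exact hw1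
      rw [hread hjj] at h1
      have h0 := support_translate_inter_CΛ_eq_empty (K := K) hne
        (Λ := insert 0 (Fin.succ '' (S'' : Set (Fin 4)))) (Set.mem_insert_of_mem _ ⟨_, hjS'', rfl⟩)
      exact (Set.eq_empty_iff_forall_notMem.mp h0) y ⟨h1, hy⟩
  · -- injectivity of the index on the meeting members
    intro D₁ hD₁ D₂ hD₂ hm₁ hm₂ hidx
    by_cases h₁ : D₁ = Zc.comap π₂ <;> by_cases h₂ : D₂ = Zc.comap π₂
    · rw [h₁, h₂]
    · simp only [if_pos h₁, if_neg h₂] at hidx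
      have hD₂' : D₂ = strictTransformIdeal π₂ Zc E₁ := (hmem D₂ hD₂).resolve_right h₂
      exact absurd (hD₂' ▸ hm₂) (hself hidx.symm)
    · simp only [if_neg h₁, if_pos h₂] at hidx
      have hD₁' : D₁ = strictTransformIdeal π₂ Zc E₁ := (hmem D₁ hD₁).resolve_right h₁
      exact absurd (hD₁' ▸ hm₁) (hself hidx)
    · rw [(hmem D₁ hD₁).resolve_right h₁, (hmem D₂ hD₂).resolve_right h₂]

end Singleton

/-! ## §2 The depth-three step: admissibility + INVARIANT-T for the non-monotone third centre -/

section StepHistory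

variable {K : Type} [Field K] {p : ℕ} [Fact p.Prime] [CharP K p] [PerfectRing K p] [DecidableEq K]
  {W W₂ : Scheme.{0}} {π : W ⟶ P 4 K} (φ : P 4 K ⟶ W) [IsOpenImmersion φ] {π₂ : W₂ ⟶ W}
  {S S' : Finset (Fin 4)} {j j' : Fin 4} {b : Fin 4 → K} {Θ : A 4 K →+* A 4 K}

/-- **THE DEPTH-THREE STEP.** Let `π : W → 𝔸⁵_K` be any blowing up along `V(z, x_S)`, `φ : 𝔸⁵ ⟶ W` an
open-immersion chart of history `φ ≫ π = Spec (Θ ∘ ψ_j)` (`j ∈ S`, `Θ xᵢ = xᵢ + bᵢ`, `b_j = 0`, `Θ` fixing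
constants), `M` a marked ideal on `W` of multiplicity `p` with `IsMultipleBlowup M₀ π M`, `HasSNC M.boundary`,
boundary ONE member `E₁` reading `V(x_j)` on `φ`, `M|_φ = (z^p + s₁.F)·𝒪`; let `S.erase j ⊆ S'` with
`φ(V(z, x_{S'}))` closed and `p ≤ ord_{(x_{S'})} s₁.F`. Then for ANY blowing up `π₂ : W₂ → W` along the global
centre and every `j' ∈ S'`, `b'` (`b'_{j'} = 0`): (i) `IsMultipleBlowup M₀ (π₂ ≫ π) M₂` and `HasSNC M₂.boundary`;
(ii) a re-centring `Θ'` with the chart of the chart `φ''` reading `(z^p + (step p S' j' b' s₁).F)·𝒪`; (iii) for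
EVERY `S''` with `S'.erase j' ⊆ S''`, `j' ∉ S''` and the HISTORY CONDITION
`j' ∉ S.erase j ∨ (∃ k ∈ S' ∖ S, b'_k ≠ 0) ∨ (j ∈ S'' ∧ b'_j ≠ 0)`: `φ''(V(z, x_{S''}))` is CLOSED in `W₂` and
`M₂.boundary` has the TRANSLATED SHAPE relative to `(φ'', S'')` with injective index — INVARIANT-T one level
deeper, the input of `chainT_step`. -/
theorem chainT_step_history {M₀ : MarkedIdeal (P 4 K)} {M : MarkedIdeal W}
    (hσ : IsMultipleBlowup M₀ π M) (hE : HasSNC M.boundary) (hmult : M.mult = p) (s₁ : State K)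
    (hM : M.ideal.comap φ = hypSheaf p s₁.F) {E₁ : W.IdealSheafData} (hbd : M.boundary = [E₁])
    (hE₁ : E₁.comap φ = ofIdealTop (Ideal.span {coord 4 K j.succ}))
    (hj : j ∈ S) (hbj : b j = 0) (hC : ∀ c : K, Θ (C c) = C c)
    (hs : ∀ k : Fin 4, Θ (X k.succ) = X k.succ + C (b k))
    (hπ : IsBlowup π (AffineCoordBlowup.𝓘Λ 4 K (insert 0 (Fin.succ '' (S : Set (Fin 4))))))
    (hc : φ ≫ π = Spec.map (CommRingCat.ofHom
      (Θ.comp (coordBlowupSubst K (insert 0 (Fin.succ '' (S : Set (Fin 4)))) j.succ).toRingHom)))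
    (hSS' : S.erase j ⊆ S')
    (hT : IsClosed (φ '' (AffineCoordBlowup.CΛ 4 K (insert 0 (Fin.succ '' (S' : Set (Fin 4)))) : Set (P 4 K))))
    (hperm' : (p : ℕ∞) ≤ CentreBlowup.ordAlong S' s₁.F)
    (hπ₂ : IsBlowup π₂ (vanishingIdeal (closureImage φ
      ((AffineCoordBlowup.𝓘Λ 4 K (insert 0 (Fin.succ '' (S' : Set (Fin 4))))).support : Set (P 4 K)))))
    (hj' : j' ∈ S') {b' : Fin 4 → K} (hbj' : b' j' = 0) :
    IsMultipleBlowup M₀ (π₂ ≫ π) (M.transform π₂ (vanishingIdeal (closureImage φ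
        ((AffineCoordBlowup.𝓘Λ 4 K (insert 0 (Fin.succ '' (S' : Set (Fin 4))))).support : Set (P 4 K))))) ∧
      HasSNC (M.transform π₂ (vanishingIdeal (closureImage φ
        ((AffineCoordBlowup.𝓘Λ 4 K (insert 0 (Fin.succ '' (S' : Set (Fin 4))))).support : Set (P 4 K))))).boundary ∧
      ∃ (Θ' : A 4 K ≃ₐ[K] A 4 K) (h' : MvPolynomial (Fin 4) K),
        Θ' (X 0) = X 0 + rename Fin.succ h' ∧ (∀ i : Fin 4, Θ' (X i.succ) = X i.succ + C (b' i)) ∧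
        (M.transform π₂ (vanishingIdeal (closureImage φ
          ((AffineCoordBlowup.𝓘Λ 4 K (insert 0 (Fin.succ '' (S' : Set (Fin 4))))).support : Set (P 4 K))))).ideal.comap
          (Spec.map (CommRingCat.ofHom (Θ' : A 4 K →+* A 4 K)) ≫
            AffineCoordBlowup.chartImm (isBlowup_restrict_globalCentre φ _ hπ₂) (succ_mem_centreVars hj') ≫
              (π₂ ⁻¹ᵁ φ.opensRange).ι) =
          hypSheaf p (CentreBlowup.step p S' j' b' s₁).F ∧
        ∀ S'' : Finset (Fin 4), S'.erase j' ⊆ S'' → j' ∉ S'' →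
          (j' ∉ S.erase j ∨ (∃ k ∈ S' \ S, b' k ≠ 0) ∨ (j ∈ S'' ∧ b' j ≠ 0)) →
          IsClosed ((Spec.map (CommRingCat.ofHom (Θ' : A 4 K →+* A 4 K)) ≫
              AffineCoordBlowup.chartImm (isBlowup_restrict_globalCentre φ _ hπ₂) (succ_mem_centreVars hj') ≫
                (π₂ ⁻¹ᵁ φ.opensRange).ι) ''
            (AffineCoordBlowup.CΛ 4 K (insert 0 (Fin.succ '' (S'' : Set (Fin 4)))) : Set (P 4 K))) ∧
          ∃ (idx₂ : W₂.IdealSheafData → Fin 4) (cst₂ : W₂.IdealSheafData → K),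
            (∀ D₂ ∈ (M.transform π₂ (vanishingIdeal (closureImage φ
                ((AffineCoordBlowup.𝓘Λ 4 K (insert 0 (Fin.succ '' (S' : Set (Fin 4))))).support : Set (P 4 K))))).boundary,
              ((D₂.support : Set W₂) ∩ (Spec.map (CommRingCat.ofHom (Θ' : A 4 K →+* A 4 K)) ≫
                  AffineCoordBlowup.chartImm (isBlowup_restrict_globalCentre φ _ hπ₂) (succ_mem_centreVars hj') ≫
                    (π₂ ⁻¹ᵁ φ.opensRange).ι) ''
                (AffineCoordBlowup.CΛ 4 K (insert 0 (Fin.succ '' (S'' : Set (Fin 4)))) : Set (P 4 K))).Nonempty →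
              D₂.comap (Spec.map (CommRingCat.ofHom (Θ' : A 4 K →+* A 4 K)) ≫
                  AffineCoordBlowup.chartImm (isBlowup_restrict_globalCentre φ _ hπ₂) (succ_mem_centreVars hj') ≫
                    (π₂ ⁻¹ᵁ φ.opensRange).ι) =
                ofIdealTop (Ideal.span {(γ 4 K).symm (X (idx₂ D₂).succ + C (cst₂ D₂))}) ∧ (idx₂ D₂ ∈ S'' → cst₂ D₂ = 0)) ∧
            (∀ D₁ ∈ (M.transform π₂ (vanishingIdeal (closureImage φ
                ((AffineCoordBlowup.𝓘Λ 4 K (insert 0 (Fin.succ '' (S' : Set (Fin 4))))).support : Set (P 4 K))))).boundary,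
              ∀ D₂ ∈ (M.transform π₂ (vanishingIdeal (closureImage φ
                ((AffineCoordBlowup.𝓘Λ 4 K (insert 0 (Fin.succ '' (S' : Set (Fin 4))))).support : Set (P 4 K))))).boundary,
              ((D₁.support : Set W₂) ∩ (Spec.map (CommRingCat.ofHom (Θ' : A 4 K →+* A 4 K)) ≫
                  AffineCoordBlowup.chartImm (isBlowup_restrict_globalCentre φ _ hπ₂) (succ_mem_centreVars hj') ≫
                    (π₂ ⁻¹ᵁ φ.opensRange).ι) ''
                (AffineCoordBlowup.CΛ 4 K (insert 0 (Fin.succ '' (S'' : Set (Fin 4)))) : Set (P 4 K))).Nonempty →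
              ((D₂.support : Set W₂) ∩ (Spec.map (CommRingCat.ofHom (Θ' : A 4 K →+* A 4 K)) ≫
                  AffineCoordBlowup.chartImm (isBlowup_restrict_globalCentre φ _ hπ₂) (succ_mem_centreVars hj') ≫
                    (π₂ ⁻¹ᵁ φ.opensRange).ι) ''
                (AffineCoordBlowup.CΛ 4 K (insert 0 (Fin.succ '' (S'' : Set (Fin 4)))) : Set (P 4 K))).Nonempty →
              idx₂ D₁ = idx₂ D₂ → D₁ = D₂) := by
  haveI : IsProper π := hπ.isProper
  haveI : IsLocallyNoetherian W := LocallyOfFiniteType.isLocallyNoetherian π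
  haveI : IsProper π₂ := hπ₂.isProper
  haveI : IsLocallyNoetherian W₂ := LocallyOfFiniteType.isLocallyNoetherian π₂
  -- the (trivial) translated shape of the one-member boundary at this level: index `j`, constant `0`
  have hshape : ∀ D ∈ M.boundary,
      ((D.support : Set W) ∩ φ '' (AffineCoordBlowup.CΛ 4 K (insert 0 (Fin.succ '' (S' : Set (Fin 4)))) : Set (P 4 K))).Nonempty →
      D.comap φ = ofIdealTop (Ideal.span {(γ 4 K).symm (X ((fun _ => j) D).succ + C ((fun _ => (0 : K)) D))}) ∧
        ((fun _ => j) D ∈ S' → (fun _ => (0 : K)) D = 0) := by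
    intro D hD _
    rw [hbd, List.mem_singleton] at hD
    subst hD
    refine ⟨?_, fun _ => rfl⟩
    rw [C_0, add_zero, hE₁]
    rfl
  have hinj : ∀ D₁ ∈ M.boundary, ∀ D₂ ∈ M.boundary,
      ((D₁.support : Set W) ∩ φ '' (AffineCoordBlowup.CΛ 4 K (insert 0 (Fin.succ '' (S' : Set (Fin 4)))) : Set (P 4 K))).Nonempty →
      ((D₂.support : Set W) ∩ φ '' (AffineCoordBlowup.CΛ 4 K (insert 0 (Fin.succ '' (S' : Set (Fin 4)))) : Set (P 4 K))).Nonempty →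
      (fun _ => j) D₁ = (fun _ => j) D₂ → D₁ = D₂ := by
    intro D₁ hD₁ D₂ hD₂ _ _ _
    rw [hbd, List.mem_singleton] at hD₁ hD₂
    rw [hD₁, hD₂]
  have hEc := hasSNCWith_globalCentre_of_shapeT φ hT hE (fun _ => j) (fun _ => (0 : K)) hshape hinj
  obtain ⟨Θ', h', h0', hs', hcI⟩ := transform_ideal_chart_of_chart φ M hmult s₁ hM hπ₂ hj' hbj' hperm'
  haveI : IsIso (CommRingCat.ofHom (Θ' : A 4 K →+* A 4 K)) :=
    (inferInstance : IsIso Θ'.toRingEquiv.toCommRingCatIso.hom)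
  have hs'' : ∀ i : Fin 4, (Θ' : A 4 K →+* A 4 K) (X i.succ) = X i.succ + C (b' i) := fun i => hs' i
  refine ⟨IsMultipleBlowup.blowup hσ _ π₂ hπ₂ (isRegular_globalCentre φ hT)
      (support_globalCentre_subset_support φ hT hmult hM hperm') hEc,
    MarkedIdeal.hasSNC_transform_boundary M hEc hπ₂, Θ', h', h0', hs', hcI, fun S'' hS'S'' hj'S'' hcl => ⟨?_, ?_⟩⟩
  · exact (isClosed_image_CΛ_depth_three_iff φ hj hbj hC hs hπ hc hSS' hj' hbj' (fun c => Θ'.commutes c) hs''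
      hπ₂ hS'S'' hj'S'').mpr hcl
  · rw [MarkedIdeal.transform_boundary, hbd]
    exact shapeT_transform_singleton φ hπ₂ hj' hbj' hs' hE₁ S''

end StepHistory

end ChartDictionary

end Summit.ResolutionOfSingularities.ResolutionOfSingularities.Theorems.PIDim4

end
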